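import Summits.CriticalPhenomena.PercolationContinuityZ3.Theorems.Transplant.FKConnectivityAllQPat3KNetDefs
import Summits.CriticalPhenomena.PercolationContinuityZ3.Theorems.PercNearOneGluingNoHeavyLowerTailSuperTerminalQuarticTermPairs
import HarnessLib

/-!
# Connectivity correlation inequalities for `φ_{w,q}`, every `q > 0` — the class 𝒦: SURGERY ON A BRIDGE
# (deleting a slot, shrinking a slot to its virtual edge; single-edge networks)

Proof file (`--supports stmt-CriticalPhenomena-4575`), census lineage (gen 41) of LANE 2's FK sub-programme; builds on p205010
(kernel theorem, internal audit signed; external expert review pending).  No definitions, no named facts, no sorries.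

The graph-side steps of census g39's recursion for THEOREM 𝒯₂(𝒦) / THEOREM SP(W₄-free) (memo HOME/FROM-census-g39-SP-W4FREE.md §3,
HOME/FROM-census-g41-*.md) in the BRIDGE case `N = BRIDGE(Qac, Qad, Qbc, Qbd, Qcd; a, b)` (`FK.IsKNet.bridge`):
* `FK.IsKNet.two_le_card_of_ne_singleton`, **`FK.IsKNet.eq_singleton_of_card_le_one`** — a 𝒦-network with one edge IS that edge
  (after the one-sided two-sum law has shrunk a mark-free slot, the slot is the plain virtual edge);
* **`FK.IsKNet.bridge_erase_cd / _erase_ac / _erase_ad / _erase_bc / _erase_bd`** — the bridge with one slot DELETED is again a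
  𝒦-network between the poles (a series–parallel composition of the four remaining slots: `K₄ − ab − e` is series–parallel), so a
  minor deleting a plain slot is a minor of a smaller 𝒦-network (induction);
* `FK.BridgeSep.shrink_cd / _ac` (+ the pole/inner symmetries) and **`FK.IsKNet.bridge_shrink_cd / _ac / _ad / _bc / _bd`** — the
  bridge with one slot replaced by its virtual edge `{uv}` is a 𝒦-network (the three host variants of the one-sided two-sum law
  `FK.lev2C_union_free_nonneg` are minors of it).
[cite: AyyerLinussonRavichandran2025, §7 (p. 22)] [cite: Grimmett2006, §3.9 (pp. 63–64)]
-/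

namespace Summit.CriticalPhenomena.PercolationContinuityZ3.Theorems

namespace FK

open SuperTerminalQuarticTermPairs (pair_ne) -- `s(x, y) ≠ s(u, v)` on distinct pairs (landed; census g42: replaces the former `FK.sym2_ne`)

open scoped Classical

variable {V : Type*}

namespace IsKNet

variable {E : Finset (Sym2 V)} {a b : V}

/-- A 𝒦-network other than a single edge has at least two edges (every composite constructor unites two disjoint nonempty parts). [folklore] -/
theorem two_le_card_of_ne_singleton (h : IsKNet E a b) (hE : E ≠ {s(a, b)}) : 2 ≤ E.card := by
  cases h with
  | edge hab => exact absurd rfl hE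
  | series h₁ h₂ hd _ _ _ =>
    rw [Finset.card_union_of_disjoint hd]
    have := h₁.card_pos; have := h₂.card_pos; omega
  | parallel h₁ h₂ hd _ =>
    rw [Finset.card_union_of_disjoint hd]
    have := h₁.card_pos; have := h₂.card_pos; omega
  | @bridge Qac Qad Qbc Qbd Qcd _ _ c d hac had hbc hbd hcd hsep =>
    have hd : Disjoint (Qac ∪ Qad ∪ Qbc ∪ Qbd) Qcd := Finset.disjoint_union_left.2 ⟨Finset.disjoint_union_left.2
      ⟨Finset.disjoint_union_left.2 ⟨hsep.d_ac_cd, hsep.d_ad_cd⟩, hsep.d_bc_cd⟩, hsep.d_bd_cd⟩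
    rw [Finset.card_union_of_disjoint hd]
    have h1 := hcd.card_pos
    have h2 : 0 < (Qac ∪ Qad ∪ Qbc ∪ Qbd).card :=
      lt_of_lt_of_le hac.card_pos (Finset.card_le_card (by intro e he; simp only [Finset.mem_union]; tauto))
    omega

/-- **A 𝒦-network with at most one edge is the single edge between its poles.** [folklore] -/
theorem eq_singleton_of_card_le_one (h : IsKNet E a b) (hE : E.card ≤ 1) : E = {s(a, b)} := by
  by_contra hne
  have := h.two_le_card_of_ne_singleton hne
  omega

/-- A 𝒦-network has no loops. [folklore] -/
theorem not_isDiag (h : IsKNet E a b) : ∀ e ∈ E, ¬ e.IsDiag := by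
  induction h with
  | edge hab => intro e he; rw [Finset.mem_singleton] at he; subst he; exact hab
  | series _ _ _ _ _ _ ih₁ ih₂ =>
    intro e he
    rcases Finset.mem_union.1 he with h | h
    · exact ih₁ e h
    · exact ih₂ e h
  | parallel _ _ _ _ ih₁ ih₂ =>
    intro e he
    rcases Finset.mem_union.1 he with h | h
    · exact ih₁ e h
    · exact ih₂ e h
  | bridge _ _ _ _ _ _ ihac ihad ihbc ihbd ihcd =>
    intro e he
    simp only [Finset.mem_union] at he
    rcases he with (((h | h) | h) | h) | h
    · exact ihac e h
    · exact ihad e h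
    · exact ihbc e h
    · exact ihbd e h
    · exact ihcd e h

end IsKNet

/-! ### Deleting a slot of a bridge -/

section Erase

variable {Qac Qad Qbc Qbd Qcd : Finset (Sym2 V)} {a b c d : V}

/-- Two slots in series at their common skeleton vertex: `Qac ·_c Qcb` is a 𝒦-network between `a` and `b` once the slots are
disjoint, their spans meet only in `c`, and the far poles are off the other slot. [folklore] -/
theorem IsKNet.series_via {Q₁ Q₂ : Finset (Sym2 V)} {a c b : V} (h₁ : IsKNet Q₁ a c) (h₂ : IsKNet Q₂ b c) (hd : Disjoint Q₁ Q₂)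
    (hV : ∀ z : V, (∃ e ∈ Q₁, z ∈ e) → (∃ e ∈ Q₂, z ∈ e) → z = c) : IsKNet (Q₁ ∪ Q₂) a b := by
  refine IsKNet.series h₁ h₂.symm hd hV ?_ ?_
  · intro e he hae
    exact h₁.ne (hV a h₁.left_mem ⟨e, he, hae⟩)
  · intro e he hbe
    exact h₂.ne (hV b ⟨e, he, hbe⟩ h₂.left_mem)

/-- **The bridge minus the slot `cd` is a 𝒦-network between the poles**: `(Qac ·_c Qcb) ∥ (Qad ·_d Qdb)`. [folklore] -/
theorem IsKNet.bridge_erase_cd (hac : IsKNet Qac a c) (had : IsKNet Qad a d) (hbc : IsKNet Qbc b c) (hbd : IsKNet Qbd b d)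
    (hsep : BridgeSep Qac Qad Qbc Qbd Qcd a b c d) : IsKNet (Qac ∪ Qad ∪ Qbc ∪ Qbd) a b := by
  have h₁ : IsKNet (Qac ∪ Qbc) a b := hac.series_via hbc hsep.d_ac_bc hsep.v_ac_bc
  have h₂ : IsKNet (Qad ∪ Qbd) a b := had.series_via hbd hsep.d_ad_bd hsep.v_ad_bd
  have hE : Qac ∪ Qad ∪ Qbc ∪ Qbd = (Qac ∪ Qbc) ∪ (Qad ∪ Qbd) := by
    ext e; simp only [Finset.mem_union]; tauto
  rw [hE]
  refine IsKNet.parallel h₁ h₂ ?_ ?_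
  · exact Finset.disjoint_union_left.2 ⟨Finset.disjoint_union_right.2 ⟨hsep.d_ac_ad, hsep.d_ac_bd⟩,
      Finset.disjoint_union_right.2 ⟨hsep.d_ad_bc.symm, hsep.d_bc_bd⟩⟩
  · intro z hz₁ hz₂
    obtain ⟨e, he, hze⟩ := hz₁
    obtain ⟨f, hf, hzf⟩ := hz₂
    rcases Finset.mem_union.1 he with he | he <;> rcases Finset.mem_union.1 hf with hf | hf
    · exact Or.inl (hsep.v_ac_ad z ⟨e, he, hze⟩ ⟨f, hf, hzf⟩)
    · exact (hsep.v_ac_bd z ⟨e, he, hze⟩ ⟨f, hf, hzf⟩).elim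
    · exact (hsep.v_ad_bc z ⟨f, hf, hzf⟩ ⟨e, he, hze⟩).elim
    · exact Or.inr (hsep.v_bc_bd z ⟨e, he, hze⟩ ⟨f, hf, hzf⟩)

/-- **The bridge minus the slot `ac` is a 𝒦-network between the poles**: `Qad ·_d ((Qdc ·_c Qcb) ∥ Qdb)`. [folklore] -/
theorem IsKNet.bridge_erase_ac (had : IsKNet Qad a d) (hbc : IsKNet Qbc b c) (hbd : IsKNet Qbd b d) (hcd : IsKNet Qcd c d)
    (hsep : BridgeSep Qac Qad Qbc Qbd Qcd a b c d) : IsKNet (Qad ∪ Qbc ∪ Qbd ∪ Qcd) a b := by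
  -- the path `d — c — b` through the slots `cd`, `bc`
  have hP : IsKNet (Qcd ∪ Qbc) d b :=
    hcd.symm.series_via hbc hsep.d_bc_cd.symm (fun z h₁ h₂ => hsep.v_bc_cd z h₂ h₁)
  -- in parallel with the slot `bd`, between `d` and `b`
  have hR : IsKNet (Qcd ∪ Qbc ∪ Qbd) d b := by
    refine IsKNet.parallel hP hbd.symm (Finset.disjoint_union_left.2 ⟨hsep.d_bd_cd.symm, hsep.d_bc_bd⟩) ?_
    intro z hz₁ hz₂
    obtain ⟨e, he, hze⟩ := hz₁
    rcases Finset.mem_union.1 he with he | he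
    · exact Or.inl (hsep.v_bd_cd z hz₂ ⟨e, he, hze⟩)
    · exact Or.inr (hsep.v_bc_bd z ⟨e, he, hze⟩ hz₂)
  -- in series after the slot `ad`, at `d`
  have hE : Qad ∪ Qbc ∪ Qbd ∪ Qcd = Qad ∪ (Qcd ∪ Qbc ∪ Qbd) := by
    ext e; simp only [Finset.mem_union]; tauto
  rw [hE]
  refine IsKNet.series had hR ?_ ?_ ?_ ?_
  · exact Finset.disjoint_union_right.2 ⟨Finset.disjoint_union_right.2 ⟨hsep.d_ad_cd, hsep.d_ad_bc⟩, hsep.d_ad_bd⟩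
  · intro z hz₁ hz₂
    obtain ⟨f, hf, hzf⟩ := hz₂
    simp only [Finset.mem_union] at hf
    rcases hf with (hf | hf) | hf
    · exact hsep.v_ad_cd z hz₁ ⟨f, hf, hzf⟩
    · exact (hsep.v_ad_bc z hz₁ ⟨f, hf, hzf⟩).elim
    · exact hsep.v_ad_bd z hz₁ ⟨f, hf, hzf⟩
  · intro f hf haf
    simp only [Finset.mem_union] at hf
    rcases hf with (hf | hf) | hf
    · exact had.ne (hsep.v_ad_cd a had.left_mem ⟨f, hf, haf⟩)
    · exact hsep.v_ad_bc a had.left_mem ⟨f, hf, haf⟩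
    · exact had.ne (hsep.v_ad_bd a had.left_mem ⟨f, hf, haf⟩)
  · intro e he hbe
    exact hbd.ne (hsep.v_ad_bd b ⟨e, he, hbe⟩ hbd.left_mem)

/-- **The bridge minus the slot `ad` is a 𝒦-network between the poles** (swap `c ↔ d`). [folklore] -/
theorem IsKNet.bridge_erase_ad (hac : IsKNet Qac a c) (hbc : IsKNet Qbc b c) (hbd : IsKNet Qbd b d) (hcd : IsKNet Qcd c d)
    (hsep : BridgeSep Qac Qad Qbc Qbd Qcd a b c d) : IsKNet (Qac ∪ Qbc ∪ Qbd ∪ Qcd) a b := by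
  have h := IsKNet.bridge_erase_ac hac hbd hbc hcd.symm hsep.swap_cd
  have hE : Qac ∪ Qbc ∪ Qbd ∪ Qcd = Qac ∪ Qbd ∪ Qbc ∪ Qcd := by
    ext e; simp only [Finset.mem_union]; tauto
  rw [hE]; exact h

/-- **The bridge minus the slot `bc` is a 𝒦-network between the poles** (swap the poles). [folklore] -/
theorem IsKNet.bridge_erase_bc (hac : IsKNet Qac a c) (had : IsKNet Qad a d) (hbd : IsKNet Qbd b d) (hcd : IsKNet Qcd c d)
    (hsep : BridgeSep Qac Qad Qbc Qbd Qcd a b c d) : IsKNet (Qac ∪ Qad ∪ Qbd ∪ Qcd) a b := by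
  have h := (IsKNet.bridge_erase_ac hbd hac had hcd hsep.symm).symm
  have hE : Qac ∪ Qad ∪ Qbd ∪ Qcd = Qbd ∪ Qac ∪ Qad ∪ Qcd := by
    ext e; simp only [Finset.mem_union]; tauto
  rw [hE]; exact h

/-- **The bridge minus the slot `bd` is a 𝒦-network between the poles** (swap the poles and `c ↔ d`). [folklore] -/
theorem IsKNet.bridge_erase_bd (hac : IsKNet Qac a c) (had : IsKNet Qad a d) (hbc : IsKNet Qbc b c) (hcd : IsKNet Qcd c d)
    (hsep : BridgeSep Qac Qad Qbc Qbd Qcd a b c d) : IsKNet (Qac ∪ Qad ∪ Qbc ∪ Qcd) a b := by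
  have h := (IsKNet.bridge_erase_ad hbc hac had hcd hsep.symm).symm
  have hE : Qac ∪ Qad ∪ Qbc ∪ Qcd = Qbc ∪ Qac ∪ Qad ∪ Qcd := by
    ext e; simp only [Finset.mem_union]; tauto
  rw [hE]; exact h

end Erase

/-! ### Shrinking a slot of a bridge to its virtual edge -/

section Shrink

variable {Qac Qad Qbc Qbd Qcd : Finset (Sym2 V)} {a b c d : V}

/-- The span of the single edge `uv` is `{u, v}`. [folklore] -/
theorem span_singleton_iff {u v z : V} : (∃ e ∈ ({s(u, v)} : Finset (Sym2 V)), z ∈ e) ↔ z = u ∨ z = v := by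
  constructor
  · rintro ⟨e, he, hz⟩
    rw [Finset.mem_singleton] at he; subst he
    exact Sym2.mem_iff.1 hz
  · intro h
    exact ⟨s(u, v), Finset.mem_singleton_self _, Sym2.mem_iff.2 h⟩

/-- An edge set whose span avoids one end of `uv` does not contain `uv`. [folklore] -/
theorem disjoint_singleton_of_span {Q : Finset (Sym2 V)} {u v : V} (h : ∀ e ∈ Q, u ∈ e → v ∈ e → False) :
    Disjoint Q {s(u, v)} := by
  rw [Finset.disjoint_singleton_right]
  intro huv
  exact h _ huv (Sym2.mem_mk_left _ _) (Sym2.mem_mk_right _ _)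

/-- **Shrinking the slot `cd` to its virtual edge keeps the bridge side conditions.** [folklore] -/
theorem BridgeSep.shrink_cd (hsep : BridgeSep Qac Qad Qbc Qbd Qcd a b c d) (hcd : IsKNet Qcd c d) :
    BridgeSep Qac Qad Qbc Qbd {s(c, d)} a b c d := by
  have hc : ∃ e ∈ Qcd, c ∈ e := hcd.left_mem
  have hd : ∃ e ∈ Qcd, d ∈ e := hcd.right_mem
  have hne : c ≠ d := hcd.ne
  -- the span of the new slot lies in the span of the old one
  have sub : ∀ z : V, (∃ e ∈ ({s(c, d)} : Finset (Sym2 V)), z ∈ e) → ∃ e ∈ Qcd, z ∈ e := by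
    intro z hz
    rcases span_singleton_iff.1 hz with h | h <;> subst h
    · exact hc
    · exact hd
  refine
    { d_ac_ad := hsep.d_ac_ad, d_ac_bc := hsep.d_ac_bc, d_ac_bd := hsep.d_ac_bd
      d_ac_cd := disjoint_singleton_of_span fun e he hce hde => hne (hsep.v_ac_cd d ⟨e, he, hde⟩ hd).symm
      d_ad_bc := hsep.d_ad_bc, d_ad_bd := hsep.d_ad_bd
      d_ad_cd := disjoint_singleton_of_span fun e he hce hde => hne (hsep.v_ad_cd c ⟨e, he, hce⟩ hc)
      d_bc_bd := hsep.d_bc_bd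
      d_bc_cd := disjoint_singleton_of_span fun e he hce hde => hne (hsep.v_bc_cd d ⟨e, he, hde⟩ hd).symm
      d_bd_cd := disjoint_singleton_of_span fun e he hce hde => hne (hsep.v_bd_cd c ⟨e, he, hce⟩ hc)
      v_ac_ad := hsep.v_ac_ad, v_ac_bc := hsep.v_ac_bc, v_ac_bd := hsep.v_ac_bd
      v_ac_cd := fun z h₁ h₂ => hsep.v_ac_cd z h₁ (sub z h₂)
      v_ad_bc := hsep.v_ad_bc, v_ad_bd := hsep.v_ad_bd
      v_ad_cd := fun z h₁ h₂ => hsep.v_ad_cd z h₁ (sub z h₂)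
      v_bc_bd := hsep.v_bc_bd
      v_bc_cd := fun z h₁ h₂ => hsep.v_bc_cd z h₁ (sub z h₂)
      v_bd_cd := fun z h₁ h₂ => hsep.v_bd_cd z h₁ (sub z h₂) }

/-- **Shrinking the slot `ac` to its virtual edge keeps the bridge side conditions.** [folklore] -/
theorem BridgeSep.shrink_ac (hsep : BridgeSep Qac Qad Qbc Qbd Qcd a b c d) (hac : IsKNet Qac a c) :
    BridgeSep {s(a, c)} Qad Qbc Qbd Qcd a b c d := by
  have ha : ∃ e ∈ Qac, a ∈ e := hac.left_mem
  have hc : ∃ e ∈ Qac, c ∈ e := hac.right_mem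
  have hne : a ≠ c := hac.ne
  have sub : ∀ z : V, (∃ e ∈ ({s(a, c)} : Finset (Sym2 V)), z ∈ e) → ∃ e ∈ Qac, z ∈ e := by
    intro z hz
    rcases span_singleton_iff.1 hz with h | h <;> subst h
    · exact ha
    · exact hc
  refine
    { d_ac_ad := (disjoint_singleton_of_span fun e he hae hce => hne (hsep.v_ac_ad c hc ⟨e, he, hce⟩).symm).symm
      d_ac_bc := (disjoint_singleton_of_span fun e he hae hce => hne (hsep.v_ac_bc a ha ⟨e, he, hae⟩)).symm
      d_ac_bd := (disjoint_singleton_of_span fun e he hae hce => hsep.v_ac_bd a ha ⟨e, he, hae⟩).symm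
      d_ac_cd := (disjoint_singleton_of_span fun e he hae hce => hne (hsep.v_ac_cd a ha ⟨e, he, hae⟩)).symm
      d_ad_bc := hsep.d_ad_bc, d_ad_bd := hsep.d_ad_bd, d_ad_cd := hsep.d_ad_cd, d_bc_bd := hsep.d_bc_bd
      d_bc_cd := hsep.d_bc_cd, d_bd_cd := hsep.d_bd_cd
      v_ac_ad := fun z h₁ h₂ => hsep.v_ac_ad z (sub z h₁) h₂
      v_ac_bc := fun z h₁ h₂ => hsep.v_ac_bc z (sub z h₁) h₂
      v_ac_bd := fun z h₁ h₂ => hsep.v_ac_bd z (sub z h₁) h₂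
      v_ac_cd := fun z h₁ h₂ => hsep.v_ac_cd z (sub z h₁) h₂
      v_ad_bc := hsep.v_ad_bc, v_ad_bd := hsep.v_ad_bd, v_ad_cd := hsep.v_ad_cd, v_bc_bd := hsep.v_bc_bd
      v_bc_cd := hsep.v_bc_cd, v_bd_cd := hsep.v_bd_cd }

/-- **The bridge with the slot `cd` shrunk to `{cd}` is a 𝒦-network between the poles.** [folklore] -/
theorem IsKNet.bridge_shrink_cd (hac : IsKNet Qac a c) (had : IsKNet Qad a d) (hbc : IsKNet Qbc b c) (hbd : IsKNet Qbd b d)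
    (hcd : IsKNet Qcd c d) (hsep : BridgeSep Qac Qad Qbc Qbd Qcd a b c d) :
    IsKNet (Qac ∪ Qad ∪ Qbc ∪ Qbd ∪ {s(c, d)}) a b :=
  IsKNet.bridge hac had hbc hbd (IsKNet.edge hcd.ne) (hsep.shrink_cd hcd)

/-- **The bridge with the slot `ac` shrunk to `{ac}` is a 𝒦-network between the poles.** [folklore] -/
theorem IsKNet.bridge_shrink_ac (hac : IsKNet Qac a c) (had : IsKNet Qad a d) (hbc : IsKNet Qbc b c) (hbd : IsKNet Qbd b d)
    (hcd : IsKNet Qcd c d) (hsep : BridgeSep Qac Qad Qbc Qbd Qcd a b c d) :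
    IsKNet ({s(a, c)} ∪ Qad ∪ Qbc ∪ Qbd ∪ Qcd) a b :=
  IsKNet.bridge (IsKNet.edge hac.ne) had hbc hbd hcd (hsep.shrink_ac hac)

/-- **The bridge with the slot `ad` shrunk to `{ad}` is a 𝒦-network between the poles** (swap `c ↔ d`). [folklore] -/
theorem IsKNet.bridge_shrink_ad (hac : IsKNet Qac a c) (had : IsKNet Qad a d) (hbc : IsKNet Qbc b c) (hbd : IsKNet Qbd b d)
    (hcd : IsKNet Qcd c d) (hsep : BridgeSep Qac Qad Qbc Qbd Qcd a b c d) :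
    IsKNet (Qac ∪ {s(a, d)} ∪ Qbc ∪ Qbd ∪ Qcd) a b := by
  have h := IsKNet.bridge_shrink_ac had hac hbd hbc hcd.symm hsep.swap_cd
  have hE : Qac ∪ {s(a, d)} ∪ Qbc ∪ Qbd ∪ Qcd = {s(a, d)} ∪ Qac ∪ Qbd ∪ Qbc ∪ Qcd := by
    ext e; simp only [Finset.mem_union]; tauto
  rw [hE]; exact h

/-- **The bridge with the slot `bc` shrunk to `{bc}` is a 𝒦-network between the poles** (swap the poles). [folklore] -/
theorem IsKNet.bridge_shrink_bc (hac : IsKNet Qac a c) (had : IsKNet Qad a d) (hbc : IsKNet Qbc b c) (hbd : IsKNet Qbd b d)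
    (hcd : IsKNet Qcd c d) (hsep : BridgeSep Qac Qad Qbc Qbd Qcd a b c d) :
    IsKNet (Qac ∪ Qad ∪ {s(b, c)} ∪ Qbd ∪ Qcd) a b := by
  have h := (IsKNet.bridge_shrink_ac hbc hbd hac had hcd hsep.symm).symm
  have hE : Qac ∪ Qad ∪ {s(b, c)} ∪ Qbd ∪ Qcd = {s(b, c)} ∪ Qbd ∪ Qac ∪ Qad ∪ Qcd := by
    ext e; simp only [Finset.mem_union]; tauto
  rw [hE]; exact h

/-- **The bridge with the slot `bd` shrunk to `{bd}` is a 𝒦-network between the poles** (swap the poles and `c ↔ d`). [folklore] -/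
theorem IsKNet.bridge_shrink_bd (hac : IsKNet Qac a c) (had : IsKNet Qad a d) (hbc : IsKNet Qbc b c) (hbd : IsKNet Qbd b d)
    (hcd : IsKNet Qcd c d) (hsep : BridgeSep Qac Qad Qbc Qbd Qcd a b c d) :
    IsKNet (Qac ∪ Qad ∪ Qbc ∪ {s(b, d)} ∪ Qcd) a b := by
  have h := (IsKNet.bridge_shrink_ad hbc hbd hac had hcd hsep.symm).symm
  have hE : Qac ∪ Qad ∪ Qbc ∪ {s(b, d)} ∪ Qcd = Qbc ∪ {s(b, d)} ∪ Qac ∪ Qad ∪ Qcd := by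
    ext e; simp only [Finset.mem_union]; tauto
  rw [hE]; exact h

end Shrink

/-! ### Example: `K₄` itself is a 𝒦-network (the class is strictly larger than the series–parallel one) -/

section Example

variable {a b c d : V}

/-- Two single edges with no common edge are disjoint singletons. [folklore] -/
theorem disjoint_single {x y u v : V} (h : s(x, y) ≠ s(u, v)) : Disjoint ({s(x, y)} : Finset (Sym2 V)) {s(u, v)} := by
  rw [Finset.disjoint_singleton_left, Finset.mem_singleton]; exact h

/-- The spans of two single edges sharing exactly the vertex `w` meet only in `w`. [folklore] -/
theorem span_single_inter {x y u v w z : V} (hx : x = w ∨ (x ≠ u ∧ x ≠ v)) (hy : y = w ∨ (y ≠ u ∧ y ≠ v))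
    (h₁ : ∃ e ∈ ({s(x, y)} : Finset (Sym2 V)), z ∈ e) (h₂ : ∃ e ∈ ({s(u, v)} : Finset (Sym2 V)), z ∈ e) : z = w := by
  rcases span_singleton_iff.1 h₁ with rfl | rfl
  · rcases hx with h | h
    · exact h
    · rcases span_singleton_iff.1 h₂ with h' | h'
      · exact absurd h' h.1
      · exact absurd h' h.2
  · rcases hy with h | h
    · exact h
    · rcases span_singleton_iff.1 h₂ with h' | h'
      · exact absurd h' h.1
      · exact absurd h' h.2

/-- The spans of two vertex-disjoint single edges do not meet. [folklore] -/
theorem span_single_disj {x y u v z : V} (hx : x ≠ u ∧ x ≠ v) (hy : y ≠ u ∧ y ≠ v)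
    (h₁ : ∃ e ∈ ({s(x, y)} : Finset (Sym2 V)), z ∈ e) (h₂ : ∃ e ∈ ({s(u, v)} : Finset (Sym2 V)), z ∈ e) : False := by
  rcases span_singleton_iff.1 h₁ with rfl | rfl
  · rcases span_singleton_iff.1 h₂ with h' | h'
    · exact hx.1 h'
    · exact hx.2 h'
  · rcases span_singleton_iff.1 h₂ with h' | h'
    · exact hy.1 h'
    · exact hy.2 h'

/-- **The five single edges `ac, ad, bc, bd, cd` on four distinct vertices satisfy the bridge side conditions.** [folklore] -/
theorem bridgeSep_singletons (hab : a ≠ b) (hac : a ≠ c) (had : a ≠ d) (hbc : b ≠ c) (hbd : b ≠ d) (hcd : c ≠ d) :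
    BridgeSep ({s(a, c)} : Finset (Sym2 V)) {s(a, d)} {s(b, c)} {s(b, d)} {s(c, d)} a b c d where
  d_ac_ad := disjoint_single (pair_ne (Or.inr hcd) (Or.inl had))
  d_ac_bc := disjoint_single (pair_ne (Or.inl hab) (Or.inr hbc.symm))
  d_ac_bd := disjoint_single (pair_ne (Or.inl hab) (Or.inl had))
  d_ac_cd := disjoint_single (pair_ne (Or.inl hac) (Or.inl had))
  d_ad_bc := disjoint_single (pair_ne (Or.inl hab) (Or.inl hac))
  d_ad_bd := disjoint_single (pair_ne (Or.inl hab) (Or.inr hbd.symm))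
  d_ad_cd := disjoint_single (pair_ne (Or.inl hac) (Or.inr hcd.symm))
  d_bc_bd := disjoint_single (pair_ne (Or.inr hcd) (Or.inl hbd))
  d_bc_cd := disjoint_single (pair_ne (Or.inl hbc) (Or.inl hbd))
  d_bd_cd := disjoint_single (pair_ne (Or.inl hbc) (Or.inr hcd.symm))
  v_ac_ad := fun _ h₁ h₂ => span_single_inter (Or.inl rfl) (Or.inr ⟨hac.symm, hcd⟩) h₁ h₂
  v_ac_bc := fun _ h₁ h₂ => span_single_inter (Or.inr ⟨hab, hac⟩) (Or.inl rfl) h₁ h₂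
  v_ac_bd := fun _ h₁ h₂ => span_single_disj ⟨hab, had⟩ ⟨hbc.symm, hcd⟩ h₁ h₂
  v_ac_cd := fun _ h₁ h₂ => span_single_inter (Or.inr ⟨hac, had⟩) (Or.inl rfl) h₁ h₂
  v_ad_bc := fun _ h₁ h₂ => span_single_disj ⟨hab, hac⟩ ⟨hbd.symm, hcd.symm⟩ h₁ h₂
  v_ad_bd := fun _ h₁ h₂ => span_single_inter (Or.inr ⟨hab, had⟩) (Or.inl rfl) h₁ h₂
  v_ad_cd := fun _ h₁ h₂ => span_single_inter (Or.inr ⟨hac, had⟩) (Or.inl rfl) h₁ h₂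
  v_bc_bd := fun _ h₁ h₂ => span_single_inter (Or.inl rfl) (Or.inr ⟨hbc.symm, hcd⟩) h₁ h₂
  v_bc_cd := fun _ h₁ h₂ => span_single_inter (Or.inr ⟨hbc, hbd⟩) (Or.inl rfl) h₁ h₂
  v_bd_cd := fun _ h₁ h₂ => span_single_inter (Or.inr ⟨hbc, hbd⟩) (Or.inl rfl) h₁ h₂

/-- **`K₄` is a 𝒦-network**: on four distinct vertices, `{ab} ∥ BRIDGE(ac, ad, bc, bd, cd)` between `a` and `b`.  (`K₄` is not
series–parallel: the class 𝒦 of census g39 strictly extends `FK.IsTTSP`.) [folklore] -/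
theorem isKNet_K4 (hab : a ≠ b) (hac : a ≠ c) (had : a ≠ d) (hbc : b ≠ c) (hbd : b ≠ d) (hcd : c ≠ d) :
    IsKNet ({s(a, b)} ∪ ({s(a, c)} ∪ {s(a, d)} ∪ {s(b, c)} ∪ {s(b, d)} ∪ {s(c, d)})) a b := by
  refine IsKNet.parallel (IsKNet.edge hab)
    (IsKNet.bridge (IsKNet.edge hac) (IsKNet.edge had) (IsKNet.edge hbc) (IsKNet.edge hbd) (IsKNet.edge hcd)
      (bridgeSep_singletons hab hac had hbc hbd hcd)) ?_ ?_
  · simp only [Finset.disjoint_union_right]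
    exact ⟨⟨⟨⟨disjoint_single (pair_ne (Or.inr hbc) (Or.inr hab.symm)), disjoint_single (pair_ne (Or.inr hbd) (Or.inr hab.symm))⟩,
      disjoint_single (pair_ne (Or.inl hab) (Or.inl hac))⟩, disjoint_single (pair_ne (Or.inl hab) (Or.inl had))⟩,
      disjoint_single (pair_ne (Or.inl hac) (Or.inl had))⟩
  · intro z h₁ _
    exact span_singleton_iff.1 h₁

end Example

end FK

end Summit.CriticalPhenomena.PercolationContinuityZ3.Theorems
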